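import Literature.MathematicalPhysics.QuantumFieldTheory.Balaban1983to89.B14Thm2
import Literature.MathematicalPhysics.QuantumFieldTheory.Balaban1983to89.Node00.Record13CoPH

/-!
# DAG node N11 — [III] THEOREM 2's SENTENCES READ AT THE (2.23)-DATA OF RECORD ⇒ (2.49) FOR THE EFFECTIVE ACTION OF RECORD
# (the N11 → N13 Cor.-3 edge `h249` at NODE 00's Stage-13 objects, v1.7 `CoPH`)

Cell `pub-ymgap`, YM-PLAN Track A (HUMAN RULING D-0062 ∕ D-0149 width push), seat `pub-ymgap-dag-n11-w2` (g0; WIDTH SEAT 2 on node n11 [B14]),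
route `BalabanUVNodes`, key item K1⁷ `StabilityBAtRecordR13SepCoPH` = stmt-QuantumFields-20542 (helper, `--supports`, count-neutral).  plan g77
W-SEAT-START-LIST §n11 item 2 «[III] Thm 2 p. 263 ∕ Cor. 3 p. 264 at the re-pinned record — Thm 2's large-field 𝐑-operation sentence at the ₁₃ objects by name».
[III] = [Balaban1988Convergent] (CMP 119), [B16] = [Balaban1989LargeFieldII] (CMP 122).

WHY THIS FILE.  The cell's Literature modules carry Theorem 2 of [III] ((2.43)–(2.44) p. 263: `B14.Thm2Printed`, `B14Thm2.Ineq243 ∕ Ineq244`) over the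
ABSTRACT carrier `B14.Sect2Data`, and the printed chain pp. 263–264 «taking Ω = Bʲ(Λ_j⁰), φ = φ_j in (2.43), and summing over j» ⇒ (2.45), (2.44) ⇒ (2.46),
(2.47) ⇒ (2.48), vacuum sentence, (2.23) ⇒ (2.49) as kernel theorems over REAL SEQUENCES (`B14Thm2.bound245_of_243`, `bound246_of_244`, `ineq249_of_223`).
Meanwhile NODE 00's record types the effective action (2.23) itself WITH BODY: r11's `B14.Eq225Concrete.concrete ∕ action23_concrete` on an `LFTower`, and at
Stage 13 `Node00.sect2ActionDataOfRecord F N V K S Rz s t a E_k` along a (2.18) history `s` with term-value witness `t` (the §2 form `SLaw₁₃CoPH θ p k` EXPOSES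
such a witness per history).  N13's Cor.-3 chain at the record (`B16NodeKnitRecord13CoPH.uvIneq_at_record₁₃CoPH_of_gas`) reads (2.49) as the binder
`h249 : ∀ V, B14Thm2.Ineq249 (R.A' V) …` — «[III] Thm 2's output: the N11 → N13 Cor.-3 edge AT THE RECORD».  Nothing in the tree joined the two: THIS FILE
reads Theorem 2's two displayed sentences AT THE SUMMANDS OF THE (2.23)-DATA OF RECORD and delivers (2.49) `Ineq249` for `action23` of record.

WHAT THIS FILE PROVES (0 `sorry`, 0 `def`, standard axioms; nothing of Bałaban's asserted — Theorem 2's sentences are HYPOTHESES, displayed).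
§1 GENERIC over any tower `T : Step.LFTower` with r11's concrete (2.23)-data `concrete T admE admR admB φ k a E_k`:
  `eq223_action23_concrete` — (2.23) IS `B14Thm2.Eq223` with 𝐄_k = Σ_{j=1}^{k} e_j, e_j := `EjSub T admE j U − β_j(g_{j−1})·A(φ_j, U)` (the (2.25) summand = the
  left-hand side of (2.43) at Ω = Bʲ(Λ_j⁰), φ = φ_j, by (2.26)), 𝐑_k = Σ_{j=1}^{k} r_j, r_j := Σ_{X} admR·[𝐑^{(j)}(X,U) − 𝐑^{(j)}(X,1)] (the (2.30) summand = the left-hand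
  side of (2.44) at Ω = Bʲ(Λ_j⁰), reader's identification GAPS G-pv01-1 (ii)), 𝐁_k = `B240`, E_k;
  ★ `ineq249_action23_concrete_of_thm2PerScale` — (2.43)_j on e_j (E₁, β, volumes Γ_n), (2.44)_j on r_j (R₁, κ₀: THE LARGE-FIELD 𝐑-OPERATION SENTENCE), (2.48) on 𝐁_k,
  (2.46)'s located coupling inputs (`hsum`, `hsmall`, κ₀ ≥ 7), the vacuum sentence p. 264 (`E_k = EkLog + EkRest`, `VacuumRestBound`) ⇒
  `Ineq249 (action23 k U) (A(1∕g_k²(·), U)) (−EkLog) (E₁(1−L^{−β})⁻¹ + 1 + 2B₁ + E₂) Γ k`;  `exp_action23_concrete_two_sided_of_thm2PerScale` (its `exp` form).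
§2 THE CONSTANT-COUPLING CURRENCY of (2.49)∕(2.50) («−A(1∕g_k², U_k)» with the CONSTANT g_k, as the Cor.-3 chain's `h249` reads it): `smearedWilson_mono`;
  `const_le_invSq` ((2.24) under (0.20), `0 ≤ β_j`, `φ_j ≤ 1` ⇒ `1∕g_k² ≤ 1∕g_k²(x)`, from r11's defect identity `invSq_sub_const`); `const_wilson_le_smearedWilson_invSq`
  (`(1∕g_k²)·A(U) ≤ A(1∕g_k²(·), U)`); ★ `action23_concrete_le_of_thm2PerScale` (the UPPER half of (2.49) in constant-coupling currency); ★
  `ineq249_action23_concrete_constCoupling_of_phi_eq_one` (BOTH halves where every cut-off `φ_j ≡ 1`, j ≤ k — the all-small-field history, p. 259 «g_j²(x) = g_j² on the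
  last domain»: `smearedWilson_invSq_eq_const_of_phi_eq_one` from r11's `invSq_eq_const_of_phi_eq_one`).
§3 AT THE ₁₃ OBJECTS BY NAME: `ineq249_action23_sect2ActionDataOfRecord_of_thm2PerScale` ∕ `action23_sect2ActionDataOfRecord_le_of_thm2PerScale` (any §2 setting `S`,
  residual `Rz`, history `s : SeqOfRecord F ν M g K k`, witness `t`, fluctuation argument `a`) and ★★ `ineq249_action23_at_record₁₃CoPH_of_thm2` at
  `S := settingOfRecord₁₃ F N θ.toStage13Params p`, `Rz := θ.rzAt p s` (v1.7 `H`: `φ_j = θ.Phih p k s.Ω s.Λ j`), flow `flowOfRun (gOfRecord₁₃ …)` (so (0.20) is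
  `flowOfRun_satisfiesRG` and `β_j(g_{j−1}) = g_{j−1}^{−2} − g_j^{−2}`), plus the constant-coupling upper half ★ `action23_at_record₁₃CoPH_le_of_thm2` (adds only `φ_j ≤ 1` and the
  signs `0 ≤ g_{j−1}^{−2} − g_j^{−2}`, i.e. β_j ≥ 0 — the DAG's unprinted leaf `betaPositive`, displayed).
A6 ∕ BINDERS JOINTLY SATISFIABLE (№189): the displayed binders are NUMERIC sentences about a free witness, not structure hypotheses; at the zero term values
`Sect2.TermValues.zero`, the unit configuration `U = 1` (where every vacuum-subtracted summand and every `A(φ_j, 1)` vanish), `Γ ≡ 0`, `E₁ = R₁ = B₁ = E₂ = EkRest = 0`,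
κ₀ = 7 and a constant coupling `g_j = g` with `k·g⁶ ≤ 1` all of `h243 h244 h248 hsum hsmall hvac` hold — so no conclusion below is vacuous by contradiction; whether
Bałaban's terms satisfy (2.43)∕(2.44) at regular configurations is [III] §3, not this file.

HONEST FRAMING.  Count-neutral kernel bookkeeping: the printed derivation pp. 263–264 of [III] instantiated at the tree's own (2.23)-data of record; the
hypotheses (2.43)_j ∕ (2.44)_j ARE Theorem 2 (its proof = [III] §3 pp. 279–283 + [I] §§4–5, nobody's theorem in the tree: `B14.Thm2Assembly.thm2Printed_of_pointData`
reduces it to per-point data, not discharged), (2.48) and the vacuum sentence are [III]'s, (2.46)'s middle members are the cell's located step T11.F.  The junction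
`action23`-of-record ↔ the (1.72) action `R.A'` the Cor.-3 chain integrates, and «(the logarithmic terms)», stay N13's ∕ def-T's.  N11 NOT discharged; K1⁷ NOT
closed; counts unmoved (typed 28∕28 · discharged 5∕27).  One finite four-torus programme at fixed `ε = L^{−K}` (Bałaban AS PRINTED, conditional finite-𝕋⁴
bookkeeping; R4 closes only the rung `BalabanLadder.UV`); NOT ℝ⁴, NOT OS, NOT a mass gap, NOT Clay.
Sources: [III] Thm 2 (2.43)–(2.44) p. 263, (2.45)–(2.49) pp. 263–264, (2.23)–(2.25) pp. 258–259, (2.30) p. 260, (2.40) p. 261, p. 277; [B16] (0.1) pp. 355–356.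
-/

noncomputable section

open scoped BigOperators Matrix.Norms.L2Operator

namespace Summit.QuantumFields.YangMills.Theorems.BalabanUVNodesN11Thm2Ineq249AtRecord13CoPH

open Literature.MathematicalPhysics.QuantumFieldTheory.Balaban1983to89 Step B14.Eq225Concrete B14.LocalCoupling B14Thm2 Finset
open T4Continuum Node00

/-! ## §1. Generic: Theorem 2's per-scale sentences at the summands of r11's concrete (2.23)-data ⇒ (2.49) for `action23` -/

section Generic

variable {P : Params} {G : Type*} [GaugeGroup G] {Φ 𝒢 𝔄 : Type*}
variable (T : LFTower P G Φ 𝒢 𝔄) (admE : (j : ℕ) → (T.sys j).Dom → T.Pt j → Bool) (admR admB : (j : ℕ) → (T.sys j).Dom → Bool)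
  (φ : ℕ → Plaq P 0 → ℝ)

/-- **(2.23) at the concrete data IS `Eq223`** with `𝐄_k = Σ_{j=1}^{k} e_j` — `e_j = [E^{(j)}(Λ_j,g_{j−1},U) − E^{(j)}(Λ_j,g_{j−1},1)] − β_j(g_{j−1})A(φ_j,U)`, the (2.25)
summand, i.e. the left-hand side of (2.43) at `Ω = Bʲ(Λ_j⁰)`, `φ = φ_j` ((2.26)) —, `𝐑_k = Σ_{j=1}^{k} r_j` — `r_j = Σ_{X ⊂ Λ_j^{∼−1}} [𝐑^{(j)}(X,U) − 𝐑^{(j)}(X,1)]`, the (2.30)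
summand, i.e. the left-hand side of (2.44) at `Ω = Bʲ(Λ_j⁰)` (reader's identification, cell GAPS G-pv01-1 (ii)) —, `𝐁_k = B240`, `A = A(1∕g_k²(·), U)`, `E_k`.
[cite: Balaban1988Convergent, (2.23)–(2.25) pp.258–259, (2.30) p.260, (2.40) p.261] -/
theorem eq223_action23_concrete (k : ℕ) (a : 𝔄) (Ek : ℝ) (U : GaugeField P 0 G) :
    Eq223 ((concrete T admE admR admB φ k a Ek).action23 k U) (smearedWilson (invSq T.flow φ k) U)
      (∑ j ∈ Icc 1 k, (EjSub T admE j U - T.flow.β j (T.flow.g (j - 1)) * smearedWilson (φ j) U))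
      (∑ j ∈ Icc 1 k, ∑ X : (T.sys j).Dom,
        (if admR j X then ((T.R j X (T.ofBackground U)).re - (T.R j X (T.ofBackground 1)).re) else 0))
      (B240 T admB a k U) Ek := by
  unfold Eq223
  rw [action23_concrete]
  rfl

/-- **★ (2.49) FOR THE EFFECTIVE ACTION (2.23) FROM THEOREM 2's SENTENCES AT ITS SUMMANDS** — the printed chain pp. 263–264 of [III] instantiated at r11's concrete
data: «taking Ω = Bʲ(Λ_j⁰), φ = φ_j in (2.43)» = `h243` on the (2.25) summands `e_j` (constant `E₁`, exponent `β > 0`, volume majorants `Γ_n ≥ 0` of `|Γ_n|`);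
«taking Ω = Bʲ(Λ_j⁰) in (2.44)» = `h244` on the (2.30) summands `r_j` (THE LARGE-FIELD 𝐑-OPERATION SENTENCE: absolute constant `R₁`, `g_j^{κ₀}`); (2.48) = `h248` on
`𝐁_k`; the middle∕last members of (2.46) «for κ₀ ≥ 7 and g sufficiently small» = `hsum`, `hsmall` (located step T11.F); «the vacuum energy counterterm E_k, except
the terms logarithmic in coupling constants, has the same bound» = `hEk`, `hvac`.  THEN `|A_k + A(1∕g_k²(·),U) − (−EkLog)| ≤ (E₁(1−L^{−β})⁻¹ + 1 + 2B₁ + E₂)·Σ_{n=1}^{k} Γ_n`.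
Kernel: `B14Thm2.ineq249_of_223 ∘ bound245_of_243 ∘ bound246_of_244` at `eq223_action23_concrete`.  The hypotheses ARE [III] Thm 2 — not proved here.
[cite: Balaban1988Convergent, Thm 2 (2.43)–(2.44) p.263, (2.45)–(2.49) pp.263–264] -/
theorem ineq249_action23_concrete_of_thm2PerScale (k κ₀ : ℕ) (hκ : 7 ≤ κ₀) (a : 𝔄) (Ek EkLog EkRest : ℝ) (hEk : Ek = EkLog + EkRest)
    (U : GaugeField P 0 G) (E₁ R₁ B₁ L β E₂ : ℝ) (Γ : ℕ → ℝ) (hL : 1 < L) (hβ : 0 < β) (hE : 0 ≤ E₁) (hR : 0 ≤ R₁)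
    (hΓ : ∀ n, 1 ≤ n → n ≤ k → 0 ≤ Γ n)
    (h243 : ∀ j, 1 ≤ j → j ≤ k →
      |EjSub T admE j U - T.flow.β j (T.flow.g (j - 1)) * smearedWilson (φ j) U| ≤ E₁ * ∑ n ∈ Icc j k, (L ^ ((j : ℝ) - n)) ^ β * Γ n)
    (h244 : ∀ j, 1 ≤ j → j ≤ k →
      |∑ X : (T.sys j).Dom, (if admR j X then ((T.R j X (T.ofBackground U)).re - (T.R j X (T.ofBackground 1)).re) else 0)| ≤
        R₁ * (T.flow.g j) ^ κ₀ * ∑ n ∈ Icc j k, Γ n)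
    (hsum : ∀ n, 1 ≤ n → n ≤ k → ∑ j ∈ Icc 1 n, (T.flow.g j) ^ κ₀ ≤ (T.flow.g n) ^ (κ₀ - 6))
    (hsmall : ∀ n, 1 ≤ n → n ≤ k → R₁ * (T.flow.g n) ^ (κ₀ - 6) ≤ 1)
    (h248 : |B240 T admB a k U| ≤ 2 * B₁ * ∑ n ∈ Icc 1 k, Γ n)
    (hvac : VacuumRestBound EkRest E₂ Γ k) :
    Ineq249 ((concrete T admE admR admB φ k a Ek).action23 k U) (smearedWilson (invSq T.flow φ k) U) (-EkLog)
      (E₁ * (1 - L ^ (-β))⁻¹ + 1 + 2 * B₁ + E₂) Γ k := by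
  subst hEk
  have h223 := eq223_action23_concrete T admE admR admB φ k a (EkLog + EkRest) U
  refine ineq249_of_223 k κ₀ hκ _ _ _ _ _ EkLog EkRest E₁ R₁ B₁ L β E₂ T.flow.g Γ h223 ⟨?_, fun _ => ?_, h248⟩ hvac
  · obtain ⟨h1, h2⟩ := bound245_of_243 k (fun j => EjSub T admE j U - T.flow.β j (T.flow.g (j - 1)) * smearedWilson (φ j) U)
      Γ E₁ L β hL hβ hE hΓ h243
    exact le_trans h1 h2
  · exact bound246_of_244 k κ₀ _ Γ T.flow.g R₁ hR hΓ h244 hsum hsmall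

/-- **The `exp` form of (2.49) for `action23`** (how (2.49) enters (2.18) term by term on the way to (2.50): `B14Thm2.exp_action_two_sided`):
`exp(−A(1∕g_k²(·),U) − EkLog − C·ΣΓ) ≤ exp A_k(U) ≤ exp(−A(1∕g_k²(·),U) − EkLog + C·ΣΓ)`. [cite: Balaban1988Convergent, (2.49)–(2.50) p.264] -/
theorem exp_action23_concrete_two_sided_of_thm2PerScale (k κ₀ : ℕ) (hκ : 7 ≤ κ₀) (a : 𝔄) (Ek EkLog EkRest : ℝ) (hEk : Ek = EkLog + EkRest)
    (U : GaugeField P 0 G) (E₁ R₁ B₁ L β E₂ : ℝ) (Γ : ℕ → ℝ) (hL : 1 < L) (hβ : 0 < β) (hE : 0 ≤ E₁) (hR : 0 ≤ R₁)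
    (hΓ : ∀ n, 1 ≤ n → n ≤ k → 0 ≤ Γ n)
    (h243 : ∀ j, 1 ≤ j → j ≤ k →
      |EjSub T admE j U - T.flow.β j (T.flow.g (j - 1)) * smearedWilson (φ j) U| ≤ E₁ * ∑ n ∈ Icc j k, (L ^ ((j : ℝ) - n)) ^ β * Γ n)
    (h244 : ∀ j, 1 ≤ j → j ≤ k →
      |∑ X : (T.sys j).Dom, (if admR j X then ((T.R j X (T.ofBackground U)).re - (T.R j X (T.ofBackground 1)).re) else 0)| ≤
        R₁ * (T.flow.g j) ^ κ₀ * ∑ n ∈ Icc j k, Γ n)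
    (hsum : ∀ n, 1 ≤ n → n ≤ k → ∑ j ∈ Icc 1 n, (T.flow.g j) ^ κ₀ ≤ (T.flow.g n) ^ (κ₀ - 6))
    (hsmall : ∀ n, 1 ≤ n → n ≤ k → R₁ * (T.flow.g n) ^ (κ₀ - 6) ≤ 1)
    (h248 : |B240 T admB a k U| ≤ 2 * B₁ * ∑ n ∈ Icc 1 k, Γ n)
    (hvac : VacuumRestBound EkRest E₂ Γ k) :
    Real.exp (-smearedWilson (invSq T.flow φ k) U + -EkLog - (E₁ * (1 - L ^ (-β))⁻¹ + 1 + 2 * B₁ + E₂) * ∑ n ∈ Icc 1 k, Γ n) ≤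
        Real.exp ((concrete T admE admR admB φ k a Ek).action23 k U) ∧
      Real.exp ((concrete T admE admR admB φ k a Ek).action23 k U) ≤
        Real.exp (-smearedWilson (invSq T.flow φ k) U + -EkLog + (E₁ * (1 - L ^ (-β))⁻¹ + 1 + 2 * B₁ + E₂) * ∑ n ∈ Icc 1 k, Γ n) :=
  exp_action_two_sided _ _ _ _ Γ k
    (ineq249_action23_concrete_of_thm2PerScale T admE admR admB φ k κ₀ hκ a Ek EkLog EkRest hEk U E₁ R₁ B₁ L β E₂ Γ hL hβ hE hR hΓ
      h243 h244 hsum hsmall h248 hvac)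

end Generic

/-! ## §2. The constant-coupling currency: `(1∕g_k²)·A(U) ≤ A(1∕g_k²(·), U)`, the upper half of (2.49) with the CONSTANT coupling, and both halves where `φ_j ≡ 1` -/

section ConstCoupling

variable {P : Params} {G : Type*} [GaugeGroup G]

/-- Monotonicity of the smeared Wilson action in the plaquette weight (each `1 − Re tr U(∂p) ≥ 0`, `GaugeGroup.reTr_le_one`).
[cite: Balaban1988Convergent, (2.23) p.258 (bookkeeping)] -/
theorem smearedWilson_mono {w w' : Plaq P 0 → ℝ} (h : ∀ p, w p ≤ w' p) (U : GaugeField P 0 G) :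
    smearedWilson w U ≤ smearedWilson w' U := by
  unfold smearedWilson
  refine Finset.sum_le_sum fun p _ => ?_
  have h1 : 0 ≤ 1 - reTr (GaugeField.plaqHol U p) := by
    have := GaugeGroup.reTr_le_one (GaugeField.plaqHol U p)
    linarith
  exact mul_le_mul_of_nonneg_right (h p) h1

/-- **(2.24) under (0.20) with `0 ≤ β_j(g_{j−1})` and `φ_j ≤ 1`: `1∕g_k² ≤ 1∕g_k²(x)`** — the position dependence of the coupling only RAISES it above the
constant one (r11's defect identity `invSq_sub_const`: `1∕g_k²(x) − 1∕g_k² = Σ_{j≤k} β_j(g_{j−1})(1 − φ_j(x))`; p. 277 «supp(g_k^{−2}(·) − g_k^{−2}) ⊂ Z_k»).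
[cite: Balaban1988Convergent, (2.24) p.259, p.277] -/
theorem const_le_invSq (F : Flow) (φ : ℕ → Plaq P 0 → ℝ) {K k : ℕ} (hRG : F.SatisfiesRG K) (hk : k ≤ K)
    (hβ : ∀ j, 1 ≤ j → j ≤ k → 0 ≤ F.β j (F.g (j - 1))) (hφ : ∀ j, 1 ≤ j → j ≤ k → ∀ x, φ j x ≤ 1) (x : Plaq P 0) :
    1 / (F.g k) ^ 2 ≤ invSq F φ k x := by
  have h := invSq_sub_const F φ hRG hk x
  have hnn : 0 ≤ ∑ i ∈ Finset.range k, F.β (i + 1) (F.g i) * (1 - φ (i + 1) x) := by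
    refine Finset.sum_nonneg fun i hi => ?_
    rw [Finset.mem_range] at hi
    have h1 := hβ (i + 1) (by omega) (by omega)
    have h2 := hφ (i + 1) (by omega) (by omega) x
    simp only [Nat.add_sub_cancel] at h1
    exact mul_nonneg h1 (by linarith)
  linarith

/-- **`(1∕g_k²)·A(U) ≤ A(1∕g_k²(·), U)`** under (0.20), `0 ≤ β_j(g_{j−1})`, `φ_j ≤ 1` (j ≤ k). [cite: Balaban1988Convergent, (2.23)–(2.24) pp.258–259, p.277] -/
theorem const_wilson_le_smearedWilson_invSq (F : Flow) (φ : ℕ → Plaq P 0 → ℝ) {K k : ℕ} (hRG : F.SatisfiesRG K) (hk : k ≤ K)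
    (hβ : ∀ j, 1 ≤ j → j ≤ k → 0 ≤ F.β j (F.g (j - 1))) (hφ : ∀ j, 1 ≤ j → j ≤ k → ∀ x, φ j x ≤ 1) (U : GaugeField P 0 G) :
    1 / (F.g k) ^ 2 * wilsonAction4 U ≤ smearedWilson (invSq F φ k) U := by
  rw [← smearedWilson_one, ← smearedWilson_smul]
  refine smearedWilson_mono (fun p => ?_) U
  rw [mul_one]
  exact const_le_invSq F φ hRG hk hβ hφ p

/-- Where EVERY cut-off equals one (`φ_j(x) = 1`, j = 1,…,k, all plaquettes — the all-small-field history; p. 259 «g_j²(x) = g_j² on the last domain»),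
`A(1∕g_k²(·), U) = (1∕g_k²)·A(U)`. [cite: Balaban1988Convergent, (2.24) p.259] -/
theorem smearedWilson_invSq_eq_const_of_phi_eq_one (F : Flow) (φ : ℕ → Plaq P 0 → ℝ) {K k : ℕ} (hRG : F.SatisfiesRG K) (hk : k ≤ K)
    (hφ : ∀ j, 1 ≤ j → j ≤ k → ∀ x, φ j x = 1) (U : GaugeField P 0 G) :
    smearedWilson (invSq F φ k) U = 1 / (F.g k) ^ 2 * wilsonAction4 U := by
  rw [← smearedWilson_one, ← smearedWilson_smul]
  unfold smearedWilson
  refine Finset.sum_congr rfl fun p _ => ?_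
  rw [invSq_eq_const_of_phi_eq_one F φ hRG hk p (fun i hi hik => hφ i hi hik p), mul_one]

variable {Φ 𝒢 𝔄 : Type*}
variable (T : LFTower P G Φ 𝒢 𝔄) (admE : (j : ℕ) → (T.sys j).Dom → T.Pt j → Bool) (admR admB : (j : ℕ) → (T.sys j).Dom → Bool)
  (φ : ℕ → Plaq P 0 → ℝ)

/-- **★ THE UPPER HALF OF (2.49) IN CONSTANT-COUPLING CURRENCY**: under Theorem 2's sentences at the summands (as in §1) AND (0.20) up to `k`, `0 ≤ β_j(g_{j−1})`,
`φ_j ≤ 1`: `A_k(U) ≤ −(1∕g_k²)·A(U) − EkLog + (E₁(1−L^{−β})⁻¹ + 1 + 2B₁ + E₂)·Σ_{n=1}^{k} Γ_n` — the half the UPPER bound of (2.50) consumes («the first term on the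
right-hand side yields the small factors for large field characteristic functions», p. 264). [cite: Balaban1988Convergent, (2.49)–(2.50) p.264, (2.24) p.259] -/
theorem action23_concrete_le_of_thm2PerScale (k κ₀ : ℕ) (hκ : 7 ≤ κ₀) (a : 𝔄) (Ek EkLog EkRest : ℝ) (hEk : Ek = EkLog + EkRest)
    (U : GaugeField P 0 G) (E₁ R₁ B₁ L β E₂ : ℝ) (Γ : ℕ → ℝ) (hL : 1 < L) (hβ : 0 < β) (hE : 0 ≤ E₁) (hR : 0 ≤ R₁)
    (hΓ : ∀ n, 1 ≤ n → n ≤ k → 0 ≤ Γ n)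
    {K : ℕ} (hRG : T.flow.SatisfiesRG K) (hk : k ≤ K) (hβj : ∀ j, 1 ≤ j → j ≤ k → 0 ≤ T.flow.β j (T.flow.g (j - 1)))
    (hφ : ∀ j, 1 ≤ j → j ≤ k → ∀ x, φ j x ≤ 1)
    (h243 : ∀ j, 1 ≤ j → j ≤ k →
      |EjSub T admE j U - T.flow.β j (T.flow.g (j - 1)) * smearedWilson (φ j) U| ≤ E₁ * ∑ n ∈ Icc j k, (L ^ ((j : ℝ) - n)) ^ β * Γ n)
    (h244 : ∀ j, 1 ≤ j → j ≤ k →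
      |∑ X : (T.sys j).Dom, (if admR j X then ((T.R j X (T.ofBackground U)).re - (T.R j X (T.ofBackground 1)).re) else 0)| ≤
        R₁ * (T.flow.g j) ^ κ₀ * ∑ n ∈ Icc j k, Γ n)
    (hsum : ∀ n, 1 ≤ n → n ≤ k → ∑ j ∈ Icc 1 n, (T.flow.g j) ^ κ₀ ≤ (T.flow.g n) ^ (κ₀ - 6))
    (hsmall : ∀ n, 1 ≤ n → n ≤ k → R₁ * (T.flow.g n) ^ (κ₀ - 6) ≤ 1)
    (h248 : |B240 T admB a k U| ≤ 2 * B₁ * ∑ n ∈ Icc 1 k, Γ n)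
    (hvac : VacuumRestBound EkRest E₂ Γ k) :
    (concrete T admE admR admB φ k a Ek).action23 k U ≤
      -(1 / (T.flow.g k) ^ 2 * wilsonAction4 U) - EkLog + (E₁ * (1 - L ^ (-β))⁻¹ + 1 + 2 * B₁ + E₂) * ∑ n ∈ Icc 1 k, Γ n := by
  have h := ineq249_action23_concrete_of_thm2PerScale T admE admR admB φ k κ₀ hκ a Ek EkLog EkRest hEk U E₁ R₁ B₁ L β E₂ Γ hL hβ hE hR hΓ
    h243 h244 hsum hsmall h248 hvac
  unfold Ineq249 at h
  have hw := const_wilson_le_smearedWilson_invSq T.flow φ hRG hk hβj hφ U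
  have h2 := (abs_le.mp h).2
  linarith

/-- **★ (2.49) WITH THE CONSTANT COUPLING where every cut-off is one** (`φ_j ≡ 1`, j ≤ k: the all-small-field history, the term the LOWER bound of (2.50) keeps):
both halves, `Awil = (1∕g_k²)·A(U)`. [cite: Balaban1988Convergent, (2.49)–(2.50) p.264, (2.24) p.259] -/
theorem ineq249_action23_concrete_constCoupling_of_phi_eq_one (k κ₀ : ℕ) (hκ : 7 ≤ κ₀) (a : 𝔄) (Ek EkLog EkRest : ℝ)
    (hEk : Ek = EkLog + EkRest) (U : GaugeField P 0 G) (E₁ R₁ B₁ L β E₂ : ℝ) (Γ : ℕ → ℝ) (hL : 1 < L) (hβ : 0 < β) (hE : 0 ≤ E₁)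
    (hR : 0 ≤ R₁) (hΓ : ∀ n, 1 ≤ n → n ≤ k → 0 ≤ Γ n)
    {K : ℕ} (hRG : T.flow.SatisfiesRG K) (hk : k ≤ K) (hφ : ∀ j, 1 ≤ j → j ≤ k → ∀ x, φ j x = 1)
    (h243 : ∀ j, 1 ≤ j → j ≤ k →
      |EjSub T admE j U - T.flow.β j (T.flow.g (j - 1)) * smearedWilson (φ j) U| ≤ E₁ * ∑ n ∈ Icc j k, (L ^ ((j : ℝ) - n)) ^ β * Γ n)
    (h244 : ∀ j, 1 ≤ j → j ≤ k →
      |∑ X : (T.sys j).Dom, (if admR j X then ((T.R j X (T.ofBackground U)).re - (T.R j X (T.ofBackground 1)).re) else 0)| ≤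
        R₁ * (T.flow.g j) ^ κ₀ * ∑ n ∈ Icc j k, Γ n)
    (hsum : ∀ n, 1 ≤ n → n ≤ k → ∑ j ∈ Icc 1 n, (T.flow.g j) ^ κ₀ ≤ (T.flow.g n) ^ (κ₀ - 6))
    (hsmall : ∀ n, 1 ≤ n → n ≤ k → R₁ * (T.flow.g n) ^ (κ₀ - 6) ≤ 1)
    (h248 : |B240 T admB a k U| ≤ 2 * B₁ * ∑ n ∈ Icc 1 k, Γ n)
    (hvac : VacuumRestBound EkRest E₂ Γ k) :
    Ineq249 ((concrete T admE admR admB φ k a Ek).action23 k U) (1 / (T.flow.g k) ^ 2 * wilsonAction4 U) (-EkLog)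
      (E₁ * (1 - L ^ (-β))⁻¹ + 1 + 2 * B₁ + E₂) Γ k := by
  rw [← smearedWilson_invSq_eq_const_of_phi_eq_one T.flow φ hRG hk hφ U]
  exact ineq249_action23_concrete_of_thm2PerScale T admE admR admB φ k κ₀ hκ a Ek EkLog EkRest hEk U E₁ R₁ B₁ L β E₂ Γ hL hβ hE hR hΓ
    h243 h244 hsum hsmall h248 hvac

end ConstCoupling

/-! ## §3. AT THE ₁₃ OBJECTS BY NAME: the (2.23)-data of record `sect2ActionDataOfRecord` along a history, and NODE 00's Stage-13 setting ∕ residual (v1.7 `CoPH`) -/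

section OfRecord

variable {F : T4Family} {N : ℕ} [NeZero N]
variable {𝔸 : Type*} [NormedRing 𝔸] [NormedAlgebra ℂ 𝔸] [CompleteSpace 𝔸] {V : Type*}
variable {ν : Stage7Numerics} {M : ℕ} {g : ℕ → ℝ} {K k : ℕ}

/-- **(2.49) FOR THE (2.23)-ACTION OF RECORD ALONG A HISTORY `s`** (any §2 setting `S`, residual `Rz`, term-value witness `t` — e.g. the one `SLaw₁₃CoPH θ p k` exposes —,
fluctuation argument `a`, constant `E_k = EkLog + EkRest`, configuration `U`): Theorem 2's sentences READ AT THE RECORD — (2.43)_j on the (2.25) summand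
`EjSub (sect2TowerOfRecord …) (admE of record) j U − β_j(g_{j−1})·A(φ_j, U)` with `φ_j = Rz.phi j`, (2.44)_j (the large-field 𝐑-operation sentence) on the (2.30) summand
`Σ_{X ∈ 𝐃_j of record, X ⊂ Λ_j^{∼−1}(s)} Re[𝐑^{(j)}(X, (ιU,0)) − 𝐑^{(j)}(X, (ι1,0))]` of the witness `t.R` — with (2.48) on `B240`, (2.46)'s coupling inputs and the vacuum sentence ⇒
`Ineq249 ((sect2ActionDataOfRecord F N V K S Rz s t a E_k).action23 k U) (A(1∕g_k²(·),U)) (−EkLog) (E₁(1−L^{−β})⁻¹ + 1 + 2B₁ + E₂) Γ k`.  (§1 at the tower of record, `rfl`.)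
[cite: Balaban1988Convergent, Thm 2 (2.43)–(2.44) p.263, (2.45)–(2.49) pp.263–264, (2.23)–(2.25) pp.258–259, (2.30) p.260] -/
theorem ineq249_action23_sect2ActionDataOfRecord_of_thm2PerScale (S : Sect2.Setting 𝔸 (SU N)) (Rz : Sect2.Residual (F.P K) 𝔸)
    (s : SeqOfRecord F ν M g K k) (t : Sect2.TermValues (F.P K) 𝔸 V M) (a : Tk.SFluct (F.P K) V) (κ₀ : ℕ) (hκ : 7 ≤ κ₀)
    (Ek EkLog EkRest : ℝ) (hEk : Ek = EkLog + EkRest) (U : GaugeField (F.P K) 0 (SU N)) (E₁ R₁ B₁ L β E₂ : ℝ) (Γ : ℕ → ℝ)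
    (hL : 1 < L) (hβ : 0 < β) (hE : 0 ≤ E₁) (hR : 0 ≤ R₁) (hΓ : ∀ n, 1 ≤ n → n ≤ k → 0 ≤ Γ n)
    (h243 : ∀ j, 1 ≤ j → j ≤ k →
      |EjSub (sect2TowerOfRecord F N V K S Rz s t) (fun j X z => Sect2.admE (F.P K) ν M g s.Λ j (Sect2.domSites (F.P K) M j X) z) j U
          - S.flow.β j (S.flow.g (j - 1)) * smearedWilson (Rz.phi j) U| ≤ E₁ * ∑ n ∈ Icc j k, (L ^ ((j : ℝ) - n)) ^ β * Γ n)
    (h244 : ∀ j, 1 ≤ j → j ≤ k →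
      |∑ X : (Sect2.domSys (F.P K) M j).Dom, (if Sect2.admR (F.P K) ν M g s.Λ j (Sect2.domSites (F.P K) M j X) then
          ((t.R j X (Sect2.ofBackgroundC S.ι U)).re - (t.R j X (Sect2.ofBackgroundC S.ι 1)).re) else 0)| ≤
        R₁ * (S.flow.g j) ^ κ₀ * ∑ n ∈ Icc j k, Γ n)
    (hsum : ∀ n, 1 ≤ n → n ≤ k → ∑ j ∈ Icc 1 n, (S.flow.g j) ^ κ₀ ≤ (S.flow.g n) ^ (κ₀ - 6))
    (hsmall : ∀ n, 1 ≤ n → n ≤ k → R₁ * (S.flow.g n) ^ (κ₀ - 6) ≤ 1)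
    (h248 : |B240 (sect2TowerOfRecord F N V K S Rz s t) (fun j X => Sect2.admB (F.P K) ν M g s.Ω s.Λ j (Sect2.domSites (F.P K) M j X)) a k U| ≤
      2 * B₁ * ∑ n ∈ Icc 1 k, Γ n)
    (hvac : VacuumRestBound EkRest E₂ Γ k) :
    Ineq249 ((sect2ActionDataOfRecord F N V K S Rz s t a Ek).action23 k U) (smearedWilson (invSq S.flow Rz.phi k) U) (-EkLog)
      (E₁ * (1 - L ^ (-β))⁻¹ + 1 + 2 * B₁ + E₂) Γ k :=
  ineq249_action23_concrete_of_thm2PerScale (sect2TowerOfRecord F N V K S Rz s t) _ _ _ Rz.phi k κ₀ hκ a Ek EkLog EkRest hEk U E₁ R₁ B₁ L β E₂ Γ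
    hL hβ hE hR hΓ h243 h244 hsum hsmall h248 hvac

/-- **The upper half in constant-coupling currency, at the (2.23)-data of record**: add (0.20) for `S.flow` up to `k`, `0 ≤ β_j(g_{j−1})` and `φ_j ≤ 1` ⇒
`A_k(s)(U) ≤ −(1∕g_k²)·A(U) − EkLog + C·Σ_{n=1}^{k} Γ_n`. [cite: Balaban1988Convergent, (2.49)–(2.50) p.264, (2.24) p.259] -/
theorem action23_sect2ActionDataOfRecord_le_of_thm2PerScale (S : Sect2.Setting 𝔸 (SU N)) (Rz : Sect2.Residual (F.P K) 𝔸)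
    (s : SeqOfRecord F ν M g K k) (t : Sect2.TermValues (F.P K) 𝔸 V M) (a : Tk.SFluct (F.P K) V) (κ₀ : ℕ) (hκ : 7 ≤ κ₀)
    (Ek EkLog EkRest : ℝ) (hEk : Ek = EkLog + EkRest) (U : GaugeField (F.P K) 0 (SU N)) (E₁ R₁ B₁ L β E₂ : ℝ) (Γ : ℕ → ℝ)
    (hL : 1 < L) (hβ : 0 < β) (hE : 0 ≤ E₁) (hR : 0 ≤ R₁) (hΓ : ∀ n, 1 ≤ n → n ≤ k → 0 ≤ Γ n)
    {K' : ℕ} (hRG : S.flow.SatisfiesRG K') (hk : k ≤ K') (hβj : ∀ j, 1 ≤ j → j ≤ k → 0 ≤ S.flow.β j (S.flow.g (j - 1)))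
    (hφ : ∀ j, 1 ≤ j → j ≤ k → ∀ x, Rz.phi j x ≤ 1)
    (h243 : ∀ j, 1 ≤ j → j ≤ k →
      |EjSub (sect2TowerOfRecord F N V K S Rz s t) (fun j X z => Sect2.admE (F.P K) ν M g s.Λ j (Sect2.domSites (F.P K) M j X) z) j U
          - S.flow.β j (S.flow.g (j - 1)) * smearedWilson (Rz.phi j) U| ≤ E₁ * ∑ n ∈ Icc j k, (L ^ ((j : ℝ) - n)) ^ β * Γ n)
    (h244 : ∀ j, 1 ≤ j → j ≤ k →
      |∑ X : (Sect2.domSys (F.P K) M j).Dom, (if Sect2.admR (F.P K) ν M g s.Λ j (Sect2.domSites (F.P K) M j X) then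
          ((t.R j X (Sect2.ofBackgroundC S.ι U)).re - (t.R j X (Sect2.ofBackgroundC S.ι 1)).re) else 0)| ≤
        R₁ * (S.flow.g j) ^ κ₀ * ∑ n ∈ Icc j k, Γ n)
    (hsum : ∀ n, 1 ≤ n → n ≤ k → ∑ j ∈ Icc 1 n, (S.flow.g j) ^ κ₀ ≤ (S.flow.g n) ^ (κ₀ - 6))
    (hsmall : ∀ n, 1 ≤ n → n ≤ k → R₁ * (S.flow.g n) ^ (κ₀ - 6) ≤ 1)
    (h248 : |B240 (sect2TowerOfRecord F N V K S Rz s t) (fun j X => Sect2.admB (F.P K) ν M g s.Ω s.Λ j (Sect2.domSites (F.P K) M j X)) a k U| ≤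
      2 * B₁ * ∑ n ∈ Icc 1 k, Γ n)
    (hvac : VacuumRestBound EkRest E₂ Γ k) :
    (sect2ActionDataOfRecord F N V K S Rz s t a Ek).action23 k U ≤
      -(1 / (S.flow.g k) ^ 2 * wilsonAction4 U) - EkLog + (E₁ * (1 - L ^ (-β))⁻¹ + 1 + 2 * B₁ + E₂) * ∑ n ∈ Icc 1 k, Γ n :=
  action23_concrete_le_of_thm2PerScale (sect2TowerOfRecord F N V K S Rz s t) _ _ _ Rz.phi k κ₀ hκ a Ek EkLog EkRest hEk U E₁ R₁ B₁ L β E₂ Γ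
    hL hβ hE hR hΓ hRG hk hβj hφ h243 h244 hsum hsmall h248 hvac

end OfRecord

section AtRecord13

variable {F : T4Family} {N : ℕ} [NeZero N]
variable (θ : Stage13HParams F N) (p : B12.RunParams) {k : ℕ}

/-- **★★ [III] THEOREM 2's SENTENCES AT NODE 00's STAGE-13 OBJECTS ⇒ (2.49) FOR THE EFFECTIVE ACTION OF RECORD** (v1.7 `CoPH`; the N11 → N13 Cor.-3 edge `h249` in the
currency of r11's (2.23) with body).  Objects: the run `p`, a (2.18) history `s : SeqOfRecord F θ.ν θ.τ9.M (gOfRecord₁₃ F N θ.toStage13Params p) p.K k`, the §2 setting of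
record `settingOfRecord₁₃ F N θ.toStage13Params p` (flow `flowOfRun (gOfRecord₁₃ …)`: `g_j = gOfRecord₁₃ … p j`, `β_j(g_{j−1}) = g_{j−1}^{−2} − g_j^{−2}`, (0.20) by `ring`), the
HISTORY's §2 residual `θ.rzAt p s` (cut-offs `φ_j = θ.Phih p k s.Ω s.Λ j`), a term-value witness `t : Sect2.TermValues (F.P p.K) (MatA N) (FluctV N) θ.τ9.M` (the one
`SLaw₁₃CoPH θ p k` exposes for the history), fluctuation argument `a`, constant `E_k`.  HYPOTHESES (displayed; = [III] Thm 2 p. 263 + (2.48) + the vacuum sentence + (2.46)'s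
coupling inputs, AT THESE OBJECTS): `h243` (2.43)_j at Ω = Bʲ(Λ_j⁰(s)), φ = φ_j; `h244` (2.44)_j — THE LARGE-FIELD 𝐑-OPERATION SENTENCE «|Σ_{X∈𝐃_j, X⊂Λ_j, X∩Ω≠∅}[𝐑^{(j)}(X,U_k) −
𝐑^{(j)}(X,1)]| ≤ R₁ g_j^{κ₀} Σ_{n=j}^{k} |Γ_n∩Ω|» read on the witness's `t.R` over `𝐃_j` of record; `h248`; `hsum`∕`hsmall` (κ₀ ≥ 7); `hEk`∕`hvac`.  CONCLUSION:
`Ineq249 ((sect2ActionDataOfRecord F N (FluctV N) p.K (settingOfRecord₁₃ …) (θ.rzAt p s) s t a E_k).action23 k U) (A(1∕g_k²(·),U)) (−EkLog) (E₁(1−L^{−β})⁻¹ + 1 + 2B₁ + E₂) Γ k`.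
Count-neutral; nothing of Bałaban's asserted. [cite: Balaban1988Convergent, Thm 2 (2.43)–(2.44) p.263, (2.45)–(2.49) pp.263–264, (2.23)–(2.25) pp.258–259, (2.30) p.260] -/
theorem ineq249_action23_at_record₁₃CoPH_of_thm2 (s : SeqOfRecord F θ.ν θ.τ9.M (gOfRecord₁₃ F N θ.toStage13Params p) p.K k)
    (t : Sect2.TermValues (F.P p.K) (MatA N) (FluctV N) θ.τ9.M) (a : Tk.SFluct (F.P p.K) (FluctV N)) (κ₀ : ℕ) (hκ : 7 ≤ κ₀)
    (Ek EkLog EkRest : ℝ) (hEk : Ek = EkLog + EkRest) (U : GaugeField (F.P p.K) 0 (SU N)) (E₁ R₁ B₁ L β E₂ : ℝ) (Γ : ℕ → ℝ)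
    (hL : 1 < L) (hβ : 0 < β) (hE : 0 ≤ E₁) (hR : 0 ≤ R₁) (hΓ : ∀ n, 1 ≤ n → n ≤ k → 0 ≤ Γ n)
    (h243 : ∀ j, 1 ≤ j → j ≤ k →
      |EjSub (sect2TowerOfRecord F N (FluctV N) p.K (settingOfRecord₁₃ F N θ.toStage13Params p) (θ.rzAt p s) s t)
            (fun j X z => Sect2.admE (F.P p.K) θ.ν θ.τ9.M (gOfRecord₁₃ F N θ.toStage13Params p) s.Λ j (Sect2.domSites (F.P p.K) θ.τ9.M j X) z) j U
          - (1 / gOfRecord₁₃ F N θ.toStage13Params p (j - 1) ^ 2 - 1 / gOfRecord₁₃ F N θ.toStage13Params p j ^ 2) *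
              smearedWilson (θ.Phih p k s.Ω s.Λ j) U| ≤ E₁ * ∑ n ∈ Icc j k, (L ^ ((j : ℝ) - n)) ^ β * Γ n)
    (h244 : ∀ j, 1 ≤ j → j ≤ k →
      |∑ X : (Sect2.domSys (F.P p.K) θ.τ9.M j).Dom, (if Sect2.admR (F.P p.K) θ.ν θ.τ9.M (gOfRecord₁₃ F N θ.toStage13Params p) s.Λ j (Sect2.domSites (F.P p.K) θ.τ9.M j X) then
          ((t.R j X (Sect2.ofBackgroundC (ιSU N) U)).re - (t.R j X (Sect2.ofBackgroundC (ιSU N) 1)).re) else 0)| ≤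
        R₁ * (gOfRecord₁₃ F N θ.toStage13Params p j) ^ κ₀ * ∑ n ∈ Icc j k, Γ n)
    (hsum : ∀ n, 1 ≤ n → n ≤ k → ∑ j ∈ Icc 1 n, (gOfRecord₁₃ F N θ.toStage13Params p j) ^ κ₀ ≤ (gOfRecord₁₃ F N θ.toStage13Params p n) ^ (κ₀ - 6))
    (hsmall : ∀ n, 1 ≤ n → n ≤ k → R₁ * (gOfRecord₁₃ F N θ.toStage13Params p n) ^ (κ₀ - 6) ≤ 1)
    (h248 : |B240 (sect2TowerOfRecord F N (FluctV N) p.K (settingOfRecord₁₃ F N θ.toStage13Params p) (θ.rzAt p s) s t)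
        (fun j X => Sect2.admB (F.P p.K) θ.ν θ.τ9.M (gOfRecord₁₃ F N θ.toStage13Params p) s.Ω s.Λ j (Sect2.domSites (F.P p.K) θ.τ9.M j X)) a k U| ≤
      2 * B₁ * ∑ n ∈ Icc 1 k, Γ n)
    (hvac : VacuumRestBound EkRest E₂ Γ k) :
    Ineq249 ((sect2ActionDataOfRecord F N (FluctV N) p.K (settingOfRecord₁₃ F N θ.toStage13Params p) (θ.rzAt p s) s t a Ek).action23 k U)
      (smearedWilson (invSq (flowOfRun (gOfRecord₁₃ F N θ.toStage13Params p)) (θ.Phih p k s.Ω s.Λ) k) U) (-EkLog)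
      (E₁ * (1 - L ^ (-β))⁻¹ + 1 + 2 * B₁ + E₂) Γ k :=
  ineq249_action23_sect2ActionDataOfRecord_of_thm2PerScale (settingOfRecord₁₃ F N θ.toStage13Params p) (θ.rzAt p s) s t a κ₀ hκ Ek EkLog EkRest hEk U
    E₁ R₁ B₁ L β E₂ Γ hL hβ hE hR hΓ h243 h244 hsum hsmall h248 hvac

/-- **★ The upper half of (2.49) at the Stage-13 objects in the Cor.-3 chain's constant-coupling currency** («−(1∕g_k²)A(U)» with `g_k = gOfRecord₁₃ … p k`): add the printed
signs `g_{j−1}^{−2} − g_j^{−2} ≥ 0` (β_j ≥ 0: the unprinted positivity of the β-functions, DAG leaf `betaPositive` ∕ T09.F — displayed) and `φ_j ≤ 1` of the history's cut-offs ⇒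
`A_k(s)(U) ≤ −(1∕g_k²)·A(U) − EkLog + (E₁(1−L^{−β})⁻¹ + 1 + 2B₁ + E₂)·Σ_{n=1}^{k} Γ_n`; (0.20) for `flowOfRun` is `flowOfRun_satisfiesRG` (no hypothesis).
[cite: Balaban1988Convergent, (2.49)–(2.50) p.264, (2.24) p.259; Balaban1987RG1, (0.20) p.256] -/
theorem action23_at_record₁₃CoPH_le_of_thm2 (s : SeqOfRecord F θ.ν θ.τ9.M (gOfRecord₁₃ F N θ.toStage13Params p) p.K k)
    (t : Sect2.TermValues (F.P p.K) (MatA N) (FluctV N) θ.τ9.M) (a : Tk.SFluct (F.P p.K) (FluctV N)) (κ₀ : ℕ) (hκ : 7 ≤ κ₀)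
    (Ek EkLog EkRest : ℝ) (hEk : Ek = EkLog + EkRest) (U : GaugeField (F.P p.K) 0 (SU N)) (E₁ R₁ B₁ L β E₂ : ℝ) (Γ : ℕ → ℝ)
    (hL : 1 < L) (hβ : 0 < β) (hE : 0 ≤ E₁) (hR : 0 ≤ R₁) (hΓ : ∀ n, 1 ≤ n → n ≤ k → 0 ≤ Γ n)
    (hβj : ∀ j, 1 ≤ j → j ≤ k → 0 ≤ 1 / gOfRecord₁₃ F N θ.toStage13Params p (j - 1) ^ 2 - 1 / gOfRecord₁₃ F N θ.toStage13Params p j ^ 2)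
    (hφ : ∀ j, 1 ≤ j → j ≤ k → ∀ x, θ.Phih p k s.Ω s.Λ j x ≤ 1)
    (h243 : ∀ j, 1 ≤ j → j ≤ k →
      |EjSub (sect2TowerOfRecord F N (FluctV N) p.K (settingOfRecord₁₃ F N θ.toStage13Params p) (θ.rzAt p s) s t)
            (fun j X z => Sect2.admE (F.P p.K) θ.ν θ.τ9.M (gOfRecord₁₃ F N θ.toStage13Params p) s.Λ j (Sect2.domSites (F.P p.K) θ.τ9.M j X) z) j U
          - (1 / gOfRecord₁₃ F N θ.toStage13Params p (j - 1) ^ 2 - 1 / gOfRecord₁₃ F N θ.toStage13Params p j ^ 2) *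
              smearedWilson (θ.Phih p k s.Ω s.Λ j) U| ≤ E₁ * ∑ n ∈ Icc j k, (L ^ ((j : ℝ) - n)) ^ β * Γ n)
    (h244 : ∀ j, 1 ≤ j → j ≤ k →
      |∑ X : (Sect2.domSys (F.P p.K) θ.τ9.M j).Dom, (if Sect2.admR (F.P p.K) θ.ν θ.τ9.M (gOfRecord₁₃ F N θ.toStage13Params p) s.Λ j (Sect2.domSites (F.P p.K) θ.τ9.M j X) then
          ((t.R j X (Sect2.ofBackgroundC (ιSU N) U)).re - (t.R j X (Sect2.ofBackgroundC (ιSU N) 1)).re) else 0)| ≤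
        R₁ * (gOfRecord₁₃ F N θ.toStage13Params p j) ^ κ₀ * ∑ n ∈ Icc j k, Γ n)
    (hsum : ∀ n, 1 ≤ n → n ≤ k → ∑ j ∈ Icc 1 n, (gOfRecord₁₃ F N θ.toStage13Params p j) ^ κ₀ ≤ (gOfRecord₁₃ F N θ.toStage13Params p n) ^ (κ₀ - 6))
    (hsmall : ∀ n, 1 ≤ n → n ≤ k → R₁ * (gOfRecord₁₃ F N θ.toStage13Params p n) ^ (κ₀ - 6) ≤ 1)
    (h248 : |B240 (sect2TowerOfRecord F N (FluctV N) p.K (settingOfRecord₁₃ F N θ.toStage13Params p) (θ.rzAt p s) s t)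
        (fun j X => Sect2.admB (F.P p.K) θ.ν θ.τ9.M (gOfRecord₁₃ F N θ.toStage13Params p) s.Ω s.Λ j (Sect2.domSites (F.P p.K) θ.τ9.M j X)) a k U| ≤
      2 * B₁ * ∑ n ∈ Icc 1 k, Γ n)
    (hvac : VacuumRestBound EkRest E₂ Γ k) :
    (sect2ActionDataOfRecord F N (FluctV N) p.K (settingOfRecord₁₃ F N θ.toStage13Params p) (θ.rzAt p s) s t a Ek).action23 k U ≤
      -(1 / (gOfRecord₁₃ F N θ.toStage13Params p k) ^ 2 * wilsonAction4 U) - EkLog + (E₁ * (1 - L ^ (-β))⁻¹ + 1 + 2 * B₁ + E₂) * ∑ n ∈ Icc 1 k, Γ n :=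
  action23_sect2ActionDataOfRecord_le_of_thm2PerScale (settingOfRecord₁₃ F N θ.toStage13Params p) (θ.rzAt p s) s t a κ₀ hκ Ek EkLog EkRest hEk U
    E₁ R₁ B₁ L β E₂ Γ hL hβ hE hR hΓ (flowOfRun_satisfiesRG (gOfRecord₁₃ F N θ.toStage13Params p) k) le_rfl hβj hφ h243 h244 hsum hsmall h248 hvac

end AtRecord13

end Summit.QuantumFields.YangMills.Theorems.BalabanUVNodesN11Thm2Ineq249AtRecord13CoPH

end
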